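import Summits.CriticalPhenomena.SAWScalingLimit.Theorems.SAWTotalPositivityCriticalBubbleBoundKestenCutDefs

/-!
# Line `kesten-product-renewal-dictionary` (crux stmt-CriticalPhenomena-7117): the two-bridge cut, I —
the rooted polygon as a cyclic vertex function, its lexicographically extreme vertices

Proof file (lead seat c1) for the objects of `…KestenCutDefs.lean`: periodicity, adjacency and injectivity
modulo the period of `cyc n ω` for `ω ∈ Zd.sawFun 2 n e₀`; minimality / maximality of `baseIdx` / `apexIdx`;
and the neighbour lemma `cyc_baseIdx_neighbours`: the two polygon-neighbours of the lowest vertex `B` are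
`B + e₀` and `B + e₁` (Madras–Slade 1993, §1.1, Def. 3.2.1 for the objects).
-/

noncomputable section

open Literature.Probability.LatticeModels
open Literature.Probability.RandomPlanarGeometry Literature.Probability.RandomPlanarGeometry.SAW
open scoped BigOperators
open Summit.CriticalPhenomena.SAWScalingLimit.Theorems.CriticalBubbleBound.Negative (e₀ adj_zero_e₀)

namespace Summit.CriticalPhenomena.SAWScalingLimit.Theorems.CriticalBubbleBound.Kesten.Cut

variable {n : ℕ} {ω : ℕ → Site 2}

/-! ## Unit vectors -/

/-- `e₀ = (1,0)` is the coordinate vector `Pi.single 0 1`. [folklore] -/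
theorem e₀_eq_single : e₀ = Pi.single (0 : Fin 2) (1 : ℤ) := by
  unfold e₀; decide

/-- `e₁ = (0,1)` is the coordinate vector `Pi.single 1 1`. [folklore] -/
theorem eUp_eq_single : eUp = Pi.single (1 : Fin 2) (1 : ℤ) := by
  unfold eUp; decide

/-- The four lattice neighbours of a site of `ℤ²`. [folklore] -/
theorem adj_cases {x y : Site 2} (h : (zdGraph 2).Adj x y) :
    y = x + e₀ ∨ y = x + eUp ∨ y = x - e₀ ∨ y = x - eUp := by
  obtain ⟨i, hi | hi⟩ := (zdGraph_adj_iff x y).1 h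
  · fin_cases i
    · left; rw [hi, e₀_eq_single]; rfl
    · right; left; rw [hi, eUp_eq_single]; rfl
  · fin_cases i
    · right; right; left; rw [hi, e₀_eq_single]; simp
    · right; right; right; rw [hi, eUp_eq_single]; simp

/-! ## Membership facts for `ω ∈ Zd.sawFun 2 n e₀` -/

/-- Start at the origin. [cite: MadrasSlade1993, §1.1] -/
theorem apply_zero (hω : ω ∈ Zd.sawFun 2 n e₀) : ω 0 = 0 := (Zd.mem_sawFun.1 hω).1

/-- Frozen at `e₀` from time `n` on. [cite: MadrasSlade1993, §1.1] -/
theorem apply_of_le (hω : ω ∈ Zd.sawFun 2 n e₀) {i : ℕ} (hi : n ≤ i) : ω i = e₀ :=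
  (Zd.mem_sawFun.1 hω).2.1 i hi

/-- Consecutive vertices are adjacent. [cite: MadrasSlade1993, §1.1] -/
theorem apply_adj (hω : ω ∈ Zd.sawFun 2 n e₀) {i : ℕ} (hi : i < n) :
    (zdGraph 2).Adj (ω i) (ω (i + 1)) :=
  (Zd.mem_sawFun.1 hω).2.2.1 i hi

/-- Injectivity on `[0, n]`. [cite: MadrasSlade1993, §1.1] -/
theorem apply_inj (hω : ω ∈ Zd.sawFun 2 n e₀) {i j : ℕ} (hi : i ≤ n) (hj : j ≤ n)
    (h : ω i = ω j) : i = j :=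
  (Zd.mem_sawFun.1 hω).2.2.2 hi hj h

/-! ## The rooted polygon as a periodic vertex function -/

/-- On `[0, n]` the cyclic function is `ω`. [folklore] -/
theorem cyc_of_le {k : ℕ} (hk : k ≤ n) : cyc n ω k = ω k := by
  rw [cyc, Nat.mod_eq_of_lt (Nat.lt_succ_of_le hk)]

/-- Periodicity. [folklore] -/
theorem cyc_add_period (k : ℕ) : cyc n ω (k + (n + 1)) = cyc n ω k := by
  rw [cyc, cyc, Nat.add_mod_right]

/-- Periodicity (multiples). [folklore] -/
theorem cyc_add_mul_period (k q : ℕ) : cyc n ω (k + q * (n + 1)) = cyc n ω k := by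
  rw [cyc, cyc, Nat.add_mul_mod_self_right]

/-- `cyc` only depends on the residue. [folklore] -/
theorem cyc_mod (k : ℕ) : cyc n ω (k % (n + 1)) = cyc n ω k := by
  rw [cyc, cyc, Nat.mod_mod]

/-- Every cyclic value is one of the vertices `ω i`, `i ≤ n`. [folklore] -/
theorem cyc_mem (k : ℕ) : ∃ i ≤ n, cyc n ω k = ω i :=
  ⟨k % (n + 1), Nat.lt_succ_iff.1 (Nat.mod_lt _ (Nat.succ_pos n)), rfl⟩

/-- Consecutive cyclic vertices are adjacent (including across the root edge). [cite: MadrasSlade1993, Definition 3.2.1] -/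
theorem cyc_adj (hω : ω ∈ Zd.sawFun 2 n e₀) (k : ℕ) :
    (zdGraph 2).Adj (cyc n ω k) (cyc n ω (k + 1)) := by
  set r := k % (n + 1) with hr
  set q := k / (n + 1) with hq
  have hrn : r ≤ n := Nat.lt_succ_iff.1 (Nat.mod_lt _ (Nat.succ_pos n))
  have hk : cyc n ω k = ω r := rfl
  have hk1 : cyc n ω (k + 1) = cyc n ω (r + 1) := by
    conv_lhs => rw [← Nat.mod_add_div k (n + 1)]
    rw [show r + (n + 1) * q + 1 = (r + 1) + q * (n + 1) by ring, cyc_add_mul_period]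
  rw [hk, hk1]
  rcases Nat.lt_or_eq_of_le hrn with h | h
  · -- an honest step of `ω`
    rw [cyc_of_le (Nat.succ_le_of_lt h)]
    exact apply_adj hω h
  · -- the root edge `ω n = e₀ → ω 0 = 0`
    rw [h, show n + 1 = 0 + (n + 1) by ring, cyc_add_period, cyc_of_le (Nat.zero_le n),
      apply_of_le hω le_rfl, apply_zero hω]
    exact adj_zero_e₀.symm

/-- Adjacency one period minus one step ahead (i.e. one step BACK). [folklore] -/
theorem cyc_adj_back (hω : ω ∈ Zd.sawFun 2 n e₀) (k : ℕ) :
    (zdGraph 2).Adj (cyc n ω (k + n)) (cyc n ω k) := by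
  have := cyc_adj hω (k + n)
  rwa [show k + n + 1 = k + (n + 1) by ring, cyc_add_period] at this

/-- Two cyclic values coincide iff the indices agree modulo the period. [folklore] -/
theorem cyc_eq_iff (hω : ω ∈ Zd.sawFun 2 n e₀) {k k' : ℕ} :
    cyc n ω k = cyc n ω k' ↔ k % (n + 1) = k' % (n + 1) := by
  refine ⟨fun h => ?_, fun h => by rw [cyc, cyc, h]⟩
  exact apply_inj hω (Nat.lt_succ_iff.1 (Nat.mod_lt _ (Nat.succ_pos n)))
    (Nat.lt_succ_iff.1 (Nat.mod_lt _ (Nat.succ_pos n))) h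

/-- Indices at distance less than a period with equal cyclic values are equal. [folklore] -/
theorem eq_of_cyc_eq (hω : ω ∈ Zd.sawFun 2 n e₀) {k k' : ℕ} (hkk' : k ≤ k') (hlt : k' < k + (n + 1))
    (h : cyc n ω k = cyc n ω k') : k = k' := by
  rw [cyc_eq_iff hω] at h
  obtain ⟨d, rfl⟩ := Nat.exists_eq_add_of_le hkk'
  have hd : d < n + 1 := by omega
  have : d % (n + 1) = 0 := by
    have := Nat.sub_mod_eq_zero_of_mod_eq h.symm
    rwa [Nat.add_sub_cancel_left] at this
  rw [Nat.mod_eq_of_lt hd] at this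
  omega

/-! ## Lexicographic key, lowest and highest vertices -/

/-- Equal keys means equal sites. [folklore] -/
theorem key_eq_iff {i j : ℕ} : key ω i = key ω j ↔ ω i = ω j := by
  constructor
  · intro h
    have h' := toLex.injective h
    simp only [Prod.mk.injEq] at h'
    funext t
    fin_cases t
    · exact h'.1
    · exact h'.2
  · intro h; rw [key, key, h]

/-- Comparing keys: the first coordinate is monotone. [folklore] -/
theorem apply_zero_le_of_key_le {i j : ℕ} (h : key ω i ≤ key ω j) : ω i 0 ≤ ω j 0 := by
  rcases Prod.Lex.le_iff.1 h with h | h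
  · exact le_of_lt h
  · exact le_of_eq h.1

/-- A site with smaller first coordinate has smaller key. [folklore] -/
theorem key_lt_of_apply_zero_lt {i j : ℕ} (h : ω i 0 < ω j 0) : key ω i < key ω j :=
  Prod.Lex.lt_iff.2 (Or.inl h)

/-- Same first coordinate, smaller second coordinate: smaller key. [folklore] -/
theorem key_lt_of_eq_of_lt {i j : ℕ} (h0 : ω i 0 = ω j 0) (h1 : ω i 1 < ω j 1) : key ω i < key ω j :=
  Prod.Lex.lt_iff.2 (Or.inr ⟨h0, h1⟩)

/-- The base index is at most `n`. [folklore] -/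
theorem baseIdx_le : baseIdx n ω ≤ n :=
  Nat.lt_succ_iff.1 (Finset.mem_range.1 (Classical.choose_spec (Finset.exists_min_image (Finset.range (n + 1)) (key ω) ⟨0, by simp⟩)).1)

/-- The apex index is at most `n`. [folklore] -/
theorem apexIdx_le : apexIdx n ω ≤ n :=
  Nat.lt_succ_iff.1 (Finset.mem_range.1 (Classical.choose_spec (Finset.exists_max_image (Finset.range (n + 1)) (key ω) ⟨0, by simp⟩)).1)

/-- Minimality of the base key. [folklore] -/
theorem key_baseIdx_le {i : ℕ} (hi : i ≤ n) : key ω (baseIdx n ω) ≤ key ω i :=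
  (Classical.choose_spec (Finset.exists_min_image (Finset.range (n + 1)) (key ω) ⟨0, by simp⟩)).2 i (Finset.mem_range.2 (Nat.lt_succ_of_le hi))

/-- Maximality of the apex key. [folklore] -/
theorem key_le_apexIdx {i : ℕ} (hi : i ≤ n) : key ω i ≤ key ω (apexIdx n ω) :=
  (Classical.choose_spec (Finset.exists_max_image (Finset.range (n + 1)) (key ω) ⟨0, by simp⟩)).2 i (Finset.mem_range.2 (Nat.lt_succ_of_le hi))

/-- Every vertex has first coordinate at least that of `B`. [folklore] -/
theorem base_zero_le {i : ℕ} (hi : i ≤ n) : base n ω 0 ≤ ω i 0 :=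
  apply_zero_le_of_key_le (key_baseIdx_le hi)

/-- Every vertex has first coordinate at most that of `A`. [folklore] -/
theorem le_apex_zero {i : ℕ} (hi : i ≤ n) : ω i 0 ≤ apex n ω 0 :=
  apply_zero_le_of_key_le (key_le_apexIdx hi)

/-- Cyclic values have first coordinate between those of `B` and `A`. [folklore] -/
theorem base_zero_le_cyc (k : ℕ) : base n ω 0 ≤ cyc n ω k 0 ∧ cyc n ω k 0 ≤ apex n ω 0 := by
  obtain ⟨i, hi, h⟩ := cyc_mem (n := n) (ω := ω) k
  rw [h]
  exact ⟨base_zero_le hi, le_apex_zero hi⟩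

/-- No vertex is `B - e₀` (it would be lexicographically lower). [folklore] -/
theorem ne_base_sub_e₀ {i : ℕ} (hi : i ≤ n) : ω i ≠ base n ω - e₀ := by
  intro h
  have h0 : ω i 0 = base n ω 0 - 1 := by rw [h]; simp [e₀]
  have := base_zero_le (ω := ω) hi
  omega

/-- No vertex is `B - e₁` (it would be lexicographically lower). [folklore] -/
theorem ne_base_sub_eUp {i : ℕ} (hi : i ≤ n) : ω i ≠ base n ω - eUp := by
  intro h
  have h0 : ω i 0 = base n ω 0 := by rw [h]; simp
  have h1 : ω i 1 = base n ω 1 - 1 := by rw [h]; simp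
  have hlt : key ω i < key ω (baseIdx n ω) := key_lt_of_eq_of_lt h0 (by rw [h1, base]; omega)
  exact absurd (key_baseIdx_le (ω := ω) hi) (not_le.2 hlt)

/-- No vertex is `A + e₀`. [folklore] -/
theorem ne_apex_add_e₀ {i : ℕ} (hi : i ≤ n) : ω i ≠ apex n ω + e₀ := by
  intro h
  have h0 : ω i 0 = apex n ω 0 + 1 := by rw [h]; simp [e₀]
  have := le_apex_zero (ω := ω) hi
  omega

/-- `A ≠ B` as soon as there are two distinct vertices (`n ≥ 1`). [folklore] -/
theorem baseIdx_ne_apexIdx (hω : ω ∈ Zd.sawFun 2 n e₀) (hn : 1 ≤ n) : baseIdx n ω ≠ apexIdx n ω := by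
  intro h
  -- then all keys are equal, so all vertices coincide: contradiction with injectivity (`ω 0 ≠ ω 1`)
  have hall : ∀ i ≤ n, key ω i = key ω (baseIdx n ω) := fun i hi =>
    le_antisymm (h ▸ key_le_apexIdx hi) (key_baseIdx_le hi)
  have h01 : ω 0 = ω 1 := key_eq_iff.1 ((hall 0 (Nat.zero_le n)).trans (hall 1 hn).symm)
  exact absurd (apply_inj hω (Nat.zero_le n) hn h01) (by norm_num)

/-! ## The two polygon-neighbours of the lowest vertex are `B + e₀` and `B + e₁` -/

/-- `cyc` at the base index is `B`. [folklore] -/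
theorem cyc_baseIdx : cyc n ω (baseIdx n ω) = base n ω := cyc_of_le baseIdx_le

/-- The cyclic successor and predecessor of `B` are `B + e₀` and `B + e₁` in some order (`n ≥ 2`, so
that they are two distinct neighbours; `B - e₀`, `B - e₁` are excluded by minimality). [folklore] -/
theorem cyc_baseIdx_neighbours (hω : ω ∈ Zd.sawFun 2 n e₀) (hn : 2 ≤ n) :
    (cyc n ω (baseIdx n ω + 1) = base n ω + e₀ ∧ cyc n ω (baseIdx n ω + n) = base n ω + eUp) ∨
    (cyc n ω (baseIdx n ω + 1) = base n ω + eUp ∧ cyc n ω (baseIdx n ω + n) = base n ω + e₀) := by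
  set b := baseIdx n ω with hb
  -- both are lattice neighbours of `B`, among `B + e₀`, `B + e₁`
  have hnext : cyc n ω (b + 1) = base n ω + e₀ ∨ cyc n ω (b + 1) = base n ω + eUp := by
    have hadj : (zdGraph 2).Adj (base n ω) (cyc n ω (b + 1)) := by
      rw [← cyc_baseIdx]; exact cyc_adj hω b
    obtain ⟨i, hi, hci⟩ := cyc_mem (n := n) (ω := ω) (b + 1)
    rcases adj_cases hadj with h | h | h | h
    · exact Or.inl h
    · exact Or.inr h
    · exact absurd (hci ▸ h) (ne_base_sub_e₀ hi)
    · exact absurd (hci ▸ h) (ne_base_sub_eUp hi)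
  have hprev : cyc n ω (b + n) = base n ω + e₀ ∨ cyc n ω (b + n) = base n ω + eUp := by
    have hadj : (zdGraph 2).Adj (base n ω) (cyc n ω (b + n)) := by
      rw [← cyc_baseIdx]; exact (cyc_adj_back hω b).symm
    obtain ⟨i, hi, hci⟩ := cyc_mem (n := n) (ω := ω) (b + n)
    rcases adj_cases hadj with h | h | h | h
    · exact Or.inl h
    · exact Or.inr h
    · exact absurd (hci ▸ h) (ne_base_sub_e₀ hi)
    · exact absurd (hci ▸ h) (ne_base_sub_eUp hi)
  -- and they are distinct
  have hne : cyc n ω (b + 1) ≠ cyc n ω (b + n) := by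
    intro h
    have := eq_of_cyc_eq hω (by omega) (by omega) h
    omega
  rcases hnext with h1 | h1 <;> rcases hprev with h2 | h2
  · exact absurd (h1.trans h2.symm) hne
  · exact Or.inl ⟨h1, h2⟩
  · exact Or.inr ⟨h1, h2⟩
  · exact absurd (h1.trans h2.symm) hne


/-- **Neighbour lemma** (registered sub-goal; explicit-binder form of `cyc_baseIdx_neighbours`): the two
polygon-neighbours of the lowest vertex `B` are `B + e₀` and `B + e₁`. [folklore] -/
theorem baseIdx_neighbours : ∀ (n : ℕ) (ω : ℕ → Site 2), ω ∈ Zd.sawFun 2 n e₀ → 2 ≤ n → (cyc n ω (baseIdx n ω + 1) = base n ω + e₀ ∧ cyc n ω (baseIdx n ω + n) = base n ω + eUp) ∨ (cyc n ω (baseIdx n ω + 1) = base n ω + eUp ∧ cyc n ω (baseIdx n ω + n) = base n ω + e₀) :=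
  fun _ _ hω hn => cyc_baseIdx_neighbours hω hn

end Summit.CriticalPhenomena.SAWScalingLimit.Theorems.CriticalBubbleBound.Kesten.Cut

end
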